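import Literature.Probability.RandomPlanarGeometry.RestrictionDerivArcObstacle
import Literature.Probability.RandomPlanarGeometry.RestrictionMapReflection
import Literature.Probability.RandomPlanarGeometry.LoewnerSemigroup
import Literature.Analysis.Complex.UnivalentApproxIdentity
import Literature.Topology.PlaneTopology.ArcTrimming
import HarnessLib

/-!
# Iterating the arc obstacle: `Φ'_A(0) ≤ θ^N` from `N` crossings at separated scales

The multi-scale form of the estimate behind [LSW] Lemma 6.3 ("with probability → 1 the
Brownian excursion hits `A_t`", proof of Lemma 6.3): the Markov property of the excursion is
replaced by the semigroup/chain rule `Φ'_A(0) = Φ'_B(0) Φ'_{A'}(0)` for `A' ⊆ A`,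
`B = cl Φ_{A'}((A ∖ A') ∩ ℍ)` (`HullSubordination`), and the single-scale estimate
`RestrictionDerivArcObstacle.exists_restrictionDeriv_le_of_arc`.

* `HasRestrictionDeriv.eq_mul_quotientHull` — the chain rule with the quotient hull explicit;
* `exists_restrictionDeriv_le_of_arc_ratio` — scale-free single-scale estimate (ratio of radii
  fixed; dilation covariance `HasRestrictionDeriv.smulHull`);
* `exists_restrictionDeriv_step` — **one step**: if `A' ⊆ A` are `*`-hulls, `B(0, s) ∩ A' = ∅`,
  and `A ∖ A'` contains a Jordan arc crossing the cone-annulus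
  `{ρ/10 ≤ ‖z‖ ≤ ρ} ∩ {|re z| ≤ c im z}` with `ρ ≤ s/(320 √(1+c²))`, then
  `Φ'_A(0) ≤ θ Φ'_{A'}(0)`, `θ = θ(c) < 1`: the Schwarz reflection of `Φ_{A'}` is univalent on
  `B(0, s/4)` (`IsRestrictionMap.exists_reflection`), hence almost linear on the arc
  (`image_mem_cone_of_univalent`), so the image arc, trimmed (`exists_subarc_crossing`), crosses
  a cone-annulus of ratio `6` inside the quotient hull `B`, and `Φ'_B(0) ≤ θ`;
* `restrictionDeriv_le_pow` — **iteration** along a chain `A₀ ⊆ A₁ ⊆ ⋯ ⊆ A_N` of `*`-hulls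
  with such crossings: `Φ'_{A_N}(0) ≤ θ^N`.
-/

noncomputable section

open Set Filter Metric Topology Function Complex
open UpperHalfPlane (upperHalfPlaneSet isOpen_upperHalfPlaneSet)
open Literature.Analysis.Complex Literature.Topology.PlaneTopology
open scoped unitInterval Pointwise

namespace Literature.Probability.RandomPlanarGeometry

/-! ### The chain rule with the quotient hull explicit -/

/-- **Chain rule `Φ'_A(0) = Φ'_B(0) · Φ'_{A'}(0)` with `B = cl Φ_{A'}((A ∖ A') ∩ ℍ)` explicit**
(for the restriction map `Φ_{A'}` with `Φ_{A'}⁻¹ → 0` at `0` and `→ ∞` at `∞`).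
[cite: LawlerSchrammWerner2003Restriction, §2 (2.4) p. 7 with p. 8 (Semigroups)] -/
theorem HasRestrictionDeriv.eq_mul_quotientHull {A A' : Set ℂ} (hA : IsStarHull A) (hA' : IsStarHull A')
    (hsub : A' ⊆ A) {Φ' : ConformalEquiv (upperHalfPlaneSet \ A') upperHalfPlaneSet}
    (hΦ' : IsRestrictionMap A' Φ') (h0 : Tendsto Φ'.symm (𝓝[upperHalfPlaneSet] 0) (𝓝 0))
    (hinf : Tendsto Φ'.symm (cocompact ℂ ⊓ 𝓟 upperHalfPlaneSet) (cocompact ℂ))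
    {Φ : ConformalEquiv (upperHalfPlaneSet \ A) upperHalfPlaneSet} (hΦ : IsRestrictionMap A Φ)
    {d d' : ℝ} (hd : HasRestrictionDeriv A Φ d) (hd' : HasRestrictionDeriv A' Φ' d')
    {ΦB : ConformalEquiv (upperHalfPlaneSet \ quotientHull A A' Φ') upperHalfPlaneSet}
    (hΦB : IsRestrictionMap (quotientHull A A' Φ') ΦB) {dB : ℝ}
    (hdB : HasRestrictionDeriv (quotientHull A A' Φ') ΦB dB) : d = dB * d' := by
  set B := quotientHull A A' Φ' with hBdef
  have hB : IsStarHull B := hA.isStarHull_quotientHull hsub h0 hinf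
  have hprod : RestrictionConfig.IsHullProduct B A' A := ⟨hA, Φ', hΦ', hA.diff_eq_setOf_quotientHull hsub⟩
  have hP : _root_.Literature.Probability.RandomPlanarGeometry.hullProduct B A' Φ' = A :=
    hprod.hullProduct_eq hA' hB hΦ'
  have hBc := hB.isBoundedHull.isClosed
  have hA'c := hA'.isBoundedHull.isClosed
  have hPmap := hΦB.hullProduct hBc hA'c hΦ'
  have hPderiv := hdB.hullProduct hBc hA'c hΦ' hd'
  -- transport along `hullProduct B A' Φ' = A`
  have key : ∀ {C : Set ℂ} (hC : C = A) {Ψ : ConformalEquiv (upperHalfPlaneSet \ C) upperHalfPlaneSet},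
      IsRestrictionMap C Ψ → HasRestrictionDeriv C Ψ (dB * d') → d = dB * d' := by
    intro C hC Ψ hΨ hΨd
    subst hC
    have heq : EqOn Φ Ψ (upperHalfPlaneSet \ C) := fun z hz ↦ by
      rw [hΦ.unique hA hΨ hz]
    have hd'' : HasRestrictionDeriv C Φ (dB * d') := by
      refine hΨd.congr' ?_
      filter_upwards [self_mem_nhdsWithin] with z hz
      rw [heq hz]
    exact hd.unique hA hd''
  exact key hP hPmap hPderiv

/-! ### The scale-free single-scale estimate -/

/-- Dilating a Jordan arc. [folklore] -/
theorem exists_smul_arc {L : Set ℂ} (e : I ≃ₜ L) {t : ℝ} (ht : 0 < t) :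
    ∃ e' : I ≃ₜ ↥(t • L), ∀ s : I, ((e' s : ↥(t • L)) : ℂ) = t • ((e s : L) : ℂ) := by
  have hc : ContinuousOn (fun z : ℂ ↦ (t : ℂ) * z) L := (continuous_const.mul continuous_id).continuousOn
  have hi : InjOn (fun z : ℂ ↦ (t : ℂ) * z) L := fun x _ y _ h ↦
    mul_left_cancel₀ (Complex.ofReal_ne_zero.2 ht.ne') h
  obtain ⟨e', he'⟩ := exists_image_arc e hc hi
  have himage : (fun z : ℂ ↦ (t : ℂ) * z) '' L = t • L := by
    ext w; simp [Set.mem_smul_set, Complex.real_smul, eq_comm]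
  refine ⟨e'.trans (Homeomorph.setCongr himage), fun s ↦ ?_⟩
  have : (((Homeomorph.setCongr himage) (e' s) : ↥(t • L)) : ℂ) = ((e' s : _) : ℂ) := rfl
  rw [Homeomorph.trans_apply, this, he' s, Complex.real_smul]

/-- **Single-scale estimate, scale-free form**: for `0 < c` and `1 < M` there is `κ > 0` such
that every `*`-hull containing a Jordan arc which crosses the cone-annulus
`{r ≤ ‖z‖ ≤ M r} ∩ {|re z| ≤ c im z}` from the outer circle to the inner one (some `r > 0`)
has `Φ'_Q(0) ≤ 1 - κ` (dilation covariance, `HasRestrictionDeriv.smulHull`).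
[cite: LawlerSchrammWerner2003Restriction, proof of Lemma 6.3 with Prop. 3.3 proof (p. 11)] -/
theorem exists_restrictionDeriv_le_of_arc_ratio {c M : ℝ} (hc : 0 < c) (hM : 1 < M) :
    ∃ κ : ℝ, 0 < κ ∧ ∀ {Q : Set ℂ}, IsStarHull Q → ∀ {L : Set ℂ} (e : I ≃ₜ L), L ⊆ Q →
      ∀ {r : ℝ}, 0 < r → (∀ z ∈ L, r ≤ ‖z‖ ∧ ‖z‖ ≤ M * r ∧ |z.re| ≤ c * z.im) →
      ‖((e 0 : L) : ℂ)‖ = M * r → ‖((e 1 : L) : ℂ)‖ = r →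
      ∀ {Ψ : ConformalEquiv (upperHalfPlaneSet \ Q) upperHalfPlaneSet} {d : ℝ},
        IsRestrictionMap Q Ψ → HasRestrictionDeriv Q Ψ d → d ≤ 1 - κ := by
  obtain ⟨κ, hκ, hSSL⟩ := exists_restrictionDeriv_le_of_arc (r₁ := 1) (r₂ := M) hc one_pos hM
  refine ⟨κ, hκ, ?_⟩
  intro Q hQ L e hLQ r hr hL h0 h1 Ψ d hΨ hd
  have hr' : 0 < r⁻¹ := inv_pos.2 hr
  -- dilate by `r⁻¹`
  have hQ' : IsStarHull (r⁻¹ • Q) := hQ.smul hr'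
  obtain ⟨e', he'⟩ := exists_smul_arc e hr'
  have hLQ' : r⁻¹ • L ⊆ r⁻¹ • Q := Set.smul_set_mono hLQ
  have hnorm : ∀ z : ℂ, ‖r⁻¹ • z‖ = r⁻¹ * ‖z‖ := fun z ↦ by
    rw [norm_smul, Real.norm_eq_abs, abs_of_pos hr']
  have hL' : ∀ z ∈ r⁻¹ • L, 1 ≤ ‖z‖ ∧ ‖z‖ ≤ M ∧ |z.re| ≤ c * z.im := by
    rintro _ ⟨z, hz, rfl⟩
    obtain ⟨hz1, hz2, hz3⟩ := hL z hz
    refine ⟨?_, ?_, ?_⟩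
    · rw [hnorm, le_inv_mul_iff₀ hr, mul_one]; exact hz1
    · rw [hnorm, inv_mul_le_iff₀ hr, mul_comm]; exact hz2
    · simp only [Complex.real_smul, Complex.mul_re, Complex.mul_im, Complex.ofReal_re, Complex.ofReal_im,
        zero_mul, sub_zero, add_zero]
      rw [abs_mul, abs_of_pos hr']
      nlinarith
  have h0' : ‖((e' 0 : ↥(r⁻¹ • L)) : ℂ)‖ = M := by
    rw [he', hnorm, h0]; field_simp
  have h1' : ‖((e' 1 : ↥(r⁻¹ • L)) : ℂ)‖ = 1 := by
    rw [he', hnorm, h1, inv_mul_cancel₀ hr.ne']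
  exact hSSL hQ' e' hLQ' hL' h0' h1' (hΨ.smulHull hr') (hd.smulHull hr')

/-! ### One step: an arc of `A ∖ A'` at a scale where `Φ_{A'}` is almost linear -/

/-- **One step of the iteration.** There is `θ = θ(c) < 1` such that: if `A' ⊆ A` are
`*`-hulls, `B(0, s) ∩ A' = ∅`, and `A ∖ A'` contains a Jordan arc crossing the cone-annulus
`{ρ/10 ≤ ‖z‖ ≤ ρ} ∩ {|re z| ≤ c im z}` from the outer to the inner circle, where
`ρ ≤ s/(320 √(1+c²))`, then `Φ'_A(0) ≤ θ Φ'_{A'}(0)`. (Chain rule through the quotient hull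
`B`; the reflected `Φ_{A'}` is univalent on `B(0, s/4)` and almost linear on the arc, whose
trimmed image crosses a cone-annulus of ratio `6` inside `B`.)
[cite: LawlerSchrammWerner2003Restriction, proof of Lemma 6.3] -/
theorem exists_restrictionDeriv_step {c : ℝ} (hc : 0 < c) :
    ∃ θ : ℝ, θ < 1 ∧ 0 ≤ θ ∧ ∀ {A A' : Set ℂ}, IsStarHull A → IsStarHull A' → A' ⊆ A →
      ∀ {s : ℝ}, 0 < s → Disjoint (ball (0 : ℂ) s) A' →
      ∀ {L : Set ℂ} (e : I ≃ₜ L), L ⊆ A \ A' →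
      ∀ {ρ : ℝ}, 0 < ρ → ρ ≤ s / (320 * Real.sqrt (1 + c ^ 2)) →
      (∀ z ∈ L, ρ / 10 ≤ ‖z‖ ∧ ‖z‖ ≤ ρ ∧ |z.re| ≤ c * z.im) →
      ‖((e 0 : L) : ℂ)‖ = ρ → ‖((e 1 : L) : ℂ)‖ = ρ / 10 →
      ∀ {Φ : ConformalEquiv (upperHalfPlaneSet \ A) upperHalfPlaneSet}
        {Φ' : ConformalEquiv (upperHalfPlaneSet \ A') upperHalfPlaneSet} {d d' : ℝ},
        IsRestrictionMap A Φ → IsRestrictionMap A' Φ' → HasRestrictionDeriv A Φ d →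
        HasRestrictionDeriv A' Φ' d' → d ≤ θ * d' := by
  have hc' : 0 < 2 * c + 1 := by linarith
  obtain ⟨κ, hκ, hSSL⟩ := exists_restrictionDeriv_le_of_arc_ratio (M := 6) hc' (by norm_num)
  refine ⟨max 0 (1 - κ), max_lt (by norm_num) (by linarith), le_max_left _ _, ?_⟩
  intro A A' hA hA' hsub s hs hdisj L e hL ρ hρ hρs hcone h0 h1 Φ Φ' d d' hΦ hΦ' hd hd'
  have hsq : 1 ≤ Real.sqrt (1 + c ^ 2) := by
    rw [Real.le_sqrt (by norm_num) (by positivity)]; nlinarith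
  -- WLOG the restriction map of `A'` with the behaviour of its inverse at `0` and `∞`
  obtain ⟨Φ₁, hΦ₁, h0₁, hinf₁, -⟩ := hA'.exists_restrictionMap_tendsto
  have hd₁ : HasRestrictionDeriv A' Φ₁ d' := by
    refine hd'.congr' ?_
    filter_upwards [self_mem_nhdsWithin] with z hz
    rw [hΦ₁.unique hA' hΦ' hz]
  obtain ⟨d'', hd''pos, -, hd''⟩ := IsStarHull.exists_hasRestrictionDeriv_holds hA' hΦ₁
  have hd'pos : 0 < d' := by rwa [hd₁.unique hA' hd'']
  -- the quotient hull and the chain rule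
  set B := quotientHull A A' Φ₁ with hBdef
  have hB : IsStarHull B := hA.isStarHull_quotientHull hsub h0₁ hinf₁
  obtain ⟨ΦB, hΦB, -⟩ := IsStarHull.existsUnique_isRestrictionMap_holds hB
  obtain ⟨dB, -, -, hdB⟩ := IsStarHull.exists_hasRestrictionDeriv_holds hB hΦB
  have hchain : d = dB * d' := hd.eq_mul_quotientHull hA hA' hsub hΦ₁ h0₁ hinf₁ hΦ hd₁ hΦB hdB
  -- the reflected `Φ_{A'}` on `B(0, s/4)`
  have hR : 0 < s / 4 := by positivity
  have hdisj' : Disjoint (ball (0 : ℂ) (2 * (s / 4))) A' :=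
    Set.disjoint_of_subset_left (ball_subset_ball (by linarith)) hdisj
  obtain ⟨F, hFd, hFinj, hF0, hFderiv, hFeq⟩ := hΦ₁.exists_reflection hA' hd₁ hR hdisj'
  have hρ10 : 0 < ρ / 10 := by positivity
  have hLH : ∀ z ∈ L, 0 < z.im := fun z hz ↦ im_pos_of_mem_cone hc hρ10 hcone hz
  have hLball : ∀ z ∈ L, z ∈ upperHalfPlaneSet ∩ ball (0 : ℂ) (s / 4) := fun z hz ↦ by
    refine ⟨hLH z hz, ?_⟩
    rw [mem_ball_zero_iff]
    have h1 : ‖z‖ ≤ ρ := (hcone z hz).2.1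
    have h2 : s / (320 * Real.sqrt (1 + c ^ 2)) ≤ s / 320 :=
      div_le_div_of_nonneg_left hs.le (by norm_num) (by nlinarith)
    linarith
  have hFΦ : ∀ z ∈ L, F z = Φ₁ z := fun z hz ↦ hFeq (hLball z hz)
  -- the image arc
  obtain ⟨eF, heF⟩ := exists_image_arc e (hFd.continuousOn.mono fun z hz ↦ (hLball z hz).2)
    (hFinj.mono fun z hz ↦ (hLball z hz).2)
  have hcone' : ∀ z ∈ L, |(F z).re| ≤ (2 * c + 1) * (F z).im ∧ 3 / 4 * d' * ‖z‖ ≤ ‖F z‖ ∧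
      ‖F z‖ ≤ 5 / 4 * d' * ‖z‖ := fun z hz ↦ by
    refine image_mem_cone_of_univalent hR hFd hFinj hF0 hFderiv hd'pos hc (hcone z hz).2.2 ?_
    have : s / 4 / (80 * Real.sqrt (1 + c ^ 2)) = s / (320 * Real.sqrt (1 + c ^ 2)) := by
      field_simp; ring
    rw [this]
    exact (hcone z hz).2.1.trans hρs
  set r₁ : ℝ := d' * ρ / 8 with hr₁
  have hr₁pos : 0 < r₁ := by positivity
  have hstart : 6 * r₁ ≤ ‖((eF 0 : F '' L) : ℂ)‖ := by
    rw [heF]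
    have := (hcone' _ (e 0).2).2.1
    rw [h0] at this
    rw [hr₁]; linarith
  have hend : ‖((eF 1 : F '' L) : ℂ)‖ ≤ r₁ := by
    rw [heF]
    have := (hcone' _ (e 1).2).2.2
    rw [h1] at this
    rw [hr₁]; linarith
  obtain ⟨L'', e'', hsub'', h0'', h1'', hann''⟩ := exists_subarc_crossing eF (r₁ := r₁) (r₂ := 6 * r₁)
    (by linarith) hstart hend
  -- `L'' ⊆ B`
  have hL''B : L'' ⊆ B := by
    refine hsub''.trans ?_
    rintro _ ⟨z, hz, rfl⟩
    rw [hBdef, quotientHull, hFΦ z hz]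
    exact subset_closure ⟨z, ⟨hL hz, hLH z hz⟩, rfl⟩
  have hL''cone : ∀ w ∈ L'', r₁ ≤ ‖w‖ ∧ ‖w‖ ≤ 6 * r₁ ∧ |w.re| ≤ (2 * c + 1) * w.im := fun w hw ↦ by
    obtain ⟨h1w, h2w⟩ := hann'' w hw
    obtain ⟨z, hz, rfl⟩ := hsub'' hw
    exact ⟨h1w, h2w, (hcone' z hz).1⟩
  have hdB_le : dB ≤ 1 - κ := hSSL hB e'' hL''B hr₁pos hL''cone h0'' h1'' hΦB hdB
  rw [hchain]
  calc dB * d' ≤ (1 - κ) * d' := by gcongr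
    _ ≤ max 0 (1 - κ) * d' := by gcongr; exact le_max_right _ _

/-! ### Iteration -/

/-- **`Φ'_{A_N}(0) ≤ θ^N` along a chain of `N` crossings at separated scales.** For `*`-hulls
`A₀ ⊆ A₁ ⊆ ⋯ ⊆ A_N` such that, for each `k < N`, `B(0, s_k) ∩ A_k = ∅` and `A_{k+1} ∖ A_k`
contains a Jordan arc crossing the cone-annulus `{ρ_k/10 ≤ ‖z‖ ≤ ρ_k} ∩ {|re z| ≤ c im z}`
with `ρ_k ≤ s_k/(320 √(1+c²))`: `Φ'_{A_N}(0) ≤ θ^N`, `θ = θ(c) < 1`. This is the analytic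
form of "the excursion hits `A` with probability `→ 1`" in the proof of [LSW] Lemma 6.3.
[cite: LawlerSchrammWerner2003Restriction, proof of Lemma 6.3] -/
theorem restrictionDeriv_le_pow {c : ℝ} (hc : 0 < c) :
    ∃ θ : ℝ, θ < 1 ∧ 0 ≤ θ ∧ ∀ (N : ℕ) (A : ℕ → Set ℂ) (s ρ : ℕ → ℝ),
      (∀ k ≤ N, IsStarHull (A k)) → (∀ k < N, A k ⊆ A (k + 1)) →
      (∀ k < N, 0 < s k ∧ Disjoint (ball (0 : ℂ) (s k)) (A k)) →
      (∀ k < N, ∃ (L : Set ℂ) (e : I ≃ₜ L), L ⊆ A (k + 1) \ A k ∧ 0 < ρ k ∧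
          ρ k ≤ s k / (320 * Real.sqrt (1 + c ^ 2)) ∧
          (∀ z ∈ L, ρ k / 10 ≤ ‖z‖ ∧ ‖z‖ ≤ ρ k ∧ |z.re| ≤ c * z.im) ∧
          ‖((e 0 : L) : ℂ)‖ = ρ k ∧ ‖((e 1 : L) : ℂ)‖ = ρ k / 10) →
      ∀ {Φ : ConformalEquiv (upperHalfPlaneSet \ A N) upperHalfPlaneSet} {d : ℝ},
        IsRestrictionMap (A N) Φ → HasRestrictionDeriv (A N) Φ d → d ≤ θ ^ N := by
  obtain ⟨θ, hθ1, hθ0, hstep⟩ := exists_restrictionDeriv_step hc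
  refine ⟨θ, hθ1, hθ0, fun N ↦ ?_⟩
  induction N with
  | zero =>
    intro A s ρ hA _ _ _ Φ d hΦ hd
    obtain ⟨d₀, -, hd₀1, hd₀⟩ := IsStarHull.exists_hasRestrictionDeriv_holds (hA 0 le_rfl) hΦ
    rw [pow_zero, hd.unique (hA 0 le_rfl) hd₀]
    exact hd₀1
  | succ N ih =>
    intro A s ρ hA hmono hdisj harc Φ d hΦ hd
    -- the restriction map of `A N` and the induction hypothesis
    have hAN : IsStarHull (A N) := hA N (Nat.le_succ N)
    obtain ⟨Φ', hΦ', -⟩ := IsStarHull.existsUnique_isRestrictionMap_holds hAN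
    obtain ⟨d', -, -, hd'⟩ := IsStarHull.exists_hasRestrictionDeriv_holds hAN hΦ'
    have hih : d' ≤ θ ^ N :=
      ih A s ρ (fun k hk ↦ hA k (hk.trans (Nat.le_succ N))) (fun k hk ↦ hmono k (hk.trans (Nat.lt_succ_self N)))
        (fun k hk ↦ hdisj k (hk.trans (Nat.lt_succ_self N)))
        (fun k hk ↦ harc k (hk.trans (Nat.lt_succ_self N))) hΦ' hd'
    -- the step from `A N` to `A (N + 1)`
    obtain ⟨L, e, hL, hρ, hρs, hcone, h0, h1⟩ := harc N (Nat.lt_succ_self N)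
    obtain ⟨hs, hdisjN⟩ := hdisj N (Nat.lt_succ_self N)
    have hle := hstep (hA (N + 1) le_rfl) hAN (hmono N (Nat.lt_succ_self N)) hs hdisjN e hL hρ hρs
      hcone h0 h1 hΦ hΦ' hd hd'
    calc d ≤ θ * d' := hle
      _ ≤ θ * θ ^ N := by gcongr
      _ = θ ^ (N + 1) := by ring

end Literature.Probability.RandomPlanarGeometry
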